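import Summits.ABC.IUTFork.Cor312PilotKummerCompat
import HarnessLib

/-!
# Block D, team D4 — DERIVATION KIT for «Thm311Charitable_4 ∧ PinnedRegions3 → S» (S = `Cor312Vol.PilotKummerIndRelated`)

Proof-only file (D-0012) of the abc-iut cell, block D (maximally-charitable re-typings of [IUTchIII] Thm. 3.11), team D4,
seat abc-iut-D4-prv (prover (a)); rung LADDER-ABC:A2.D. Companion KIT of the team's derivation file `Charitable/Thm311D4Derive.lean`
(which imports abc-iut-D4-typ's `Charitable/Thm311D4.lean` and this kit, and carries `s_of_charitable_4` + the T-c witness). TAKES NO SIDE on [IUTchIII] Cor. 3.12. NO definition, NO `Prop` fact: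
every clause below is an INLINE HYPOTHESIS (a binder), stated over the FROZEN vocabulary of abc-iut-c312-1
(`Thm311.LatticeSituation`: `col n`, `frobΨ`, `KummerB`, `MultiradialCompat`, `RLGP`, `starAut`), abc-iut-c312-7 (`Cor312.Setting`)
and abc-iut-w5-d230 (`ThetaPinned`/`QPinned`/`PinnedRegions`/`PinnedRegions3`/`PilotKummerIndRelated`, p417551/p418935).
S. Mochizuki, *Inter-universal Teichmüller theory III*, kurims manuscript (May 2020) = `paper:url-4b091feeb646`; Thm. 3.11
pp. 153–159 (cell pack HOME/lit/THM311-VERBATIM.md); Cor. 3.12 pp. 173–174; Step (xi) pp. 181–184. [claim: Mochizuki2012, status: disputed]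

PURPOSE (director-abc 05:19:22Z, block D brief: «before the typing lands: prepare the proof skeleton over Cor312Statement's
interface and the pinned files — what WOULD a charitable (ii)/(iii) have to say to force S?»). The residual
`PilotKummerIndRelated S P ρ qK := ∀ j v_ℚ, ∃ D′ ∈ ⁿ˒°ℜ^LGP, ρ qK j v_ℚ = ρ D′.Ψ j v_ℚ` ties the q-pilot's Kummer datum `qK` (an
UNINTERPRETED binder of the pins: no frozen clause computes it — expressibility sentence of `Cor312PinnedRegions`) to the
(Ind1),(Ind2)-orbit of the line-`n` Θ-data. Hence a charitable reading of Thm. 3.11 forces S under the pins EXACTLY IF it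
carries a clause relating `qK` (as a parameter, or as a structure field instantiated as `qK`) to some column's Θ splitting-monoid
Kummer image. This file proves, once, the closing move for EACH clause shape such a reading can take, so that
`s_of_charitable_4` (in the sequel `Thm311D4Derive.lean`, written against abc-iut-D4-typ's `Thm311Charitable_4`) is a one-line
application:

| shape of the charitable clause (inline hypothesis) | printed words it would read | closing lemma | Thm 3.11 parts consumed |
|---|---|---|---|
| (K1) `qK = Φ · frobΨ_n m` (datum, same column) = `PilotKummerCompat` | (iii)(c) final clause p.158 l.5–14 «compatible with the horizontal arrows … up to (Ind1), (Ind2), (Ind3)» at the pilots | tree: `pilotKummerIndRelated_of_pilotKummerCompat` | (ii)(b) col `n` |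
| (K2) `qK = Φ · frobΨ_{n′} m` (datum, ANY column `n′`, e.g. the link's domain `n−1`) | idem, read across the link `(n−1,m) → (n,m)` | `pilotKummerIndRelated_of_transportAt` | (i) `MultiradialCompat`, (ii)(b) col `n′` |
| (K3) `qK = D′.Ψ`, `D′ ∈ ⁿ′˒°ℜ^LGP` (datum is the splitting monoid of a possible image) | (i) «ⁿ˒°ℜ^LGP … regarded up to (Ind1), (Ind2)» + (iii)(c) | `pilotKummerIndRelated_of_mem_RLGP` | (i) `MultiradialCompat` |
| (K4) `qK = Φ · ⋃ₘ frobΨ_{n′} m` (datum, literal (Ind3)-union) | (iii)(c) «up to … (Ind3)» = variation in `m` | `pilotKummerIndRelated_of_transportUnion` | (i), (ii)(b) col `n′` |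
| (K5) `ρ qK = Φ '' ρ (frobΨ_{n′} m)` per packet (region level, any column) | (xi-d) p.183 l.2–8 «linked/related … to the representation … of the q-pilot object» | `pilotKummerIndRelated_of_regionTransportAt` | (hρ) of the Θ-pin, (i), (ii)(b) col `n′` |
| (K6) `ρ qK = ρ (frobΨ_{n−1} m₀)` (region equality with the previous column) | (xi-a) p.181 l.37–44 «Θ-pilot at (0,0) corresponds to the q-pilot at (1,0)» | tree: `pilotKummerIndRelated_of_linkedGlue` | (i), (ii)(b) col `n−1` |
| (K8) `P.qRegion = Φ '' P.thetaRegion m` per packet (GLUE level, on the setting's regions) / READING R3 outright | Fig. 3.8 «two tautologically equivalent ways to compute the log-volume of the q-pilot»; (xi-a) on regions | `(pilotKummerIndRelated_iff_glueTranslate …).2` / tree `(reading3_iff_pilotKummerIndRelated …).1` | (pΘ)(pq′), (ii)(b) col `n` |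
| (K7) `qK ⊆ Φ · frobΨ m` / `ρ qK ⊆ ⁿ˒°𝒰` (INCLUSION / HULL shaped) | (Ind3) «upper semi-compatible ⊆» p.156 l.33; (xi-f) p.184 l.26 «inclusion … follows formally» | does NOT give S (S is an equality of regions); gives `Licence`/`Statement` only (`Cor312Vol.statement_of_pilotKummerCompatHull`) | — |

and (§3) the passage S ⟹ (xi-f) Licence (`licence_of_s`); S ⟹ typed Corollary is the tree's `statement_of_pinned3_of_pilotKummerIndRelated` (BridgeHyps + (ii)(b) col `n`), not restated.
KERNEL CHARACTERISATION (§2b, `pilotKummerIndRelated_iff_glueTranslate`): granted the two region pins and (ii)(b) for column `n`,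
S ⟺ «∀ j v_ℚ, ∃ Φ ∈ ⟨Ind1∪Ind2⟩, ∃ m, P.qRegion j v_ℚ = Φ j v_ℚ '' P.thetaRegion m j v_ℚ» — so task (a) closes for a
charitable typing EXACTLY IF that typing (with the pins) yields this glue-level translate clause, whatever vocabulary it uses
(its own region operator / q-datum with its own pins, new signature fields, an «algorithm»): the adapter is always (K8)'s backward direction.
NECESSITY-SIDE REMARK for T-c (no new theorem; by name): S is identification-level — under the pins and (ii)(b) it is READING R3
(`reading3_iff_pilotKummerIndRelated`), which `PinnedHonest.not_gapA''_of_scaled_of_absLogQPos` refutes on every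
honestly-`j²`-scaled, Step-(x)-invariant, `|log(q)| > 0` pin-respecting setting; so a charitable reading that yields S is
satisfiable with the pins only at settings of the `Cor312PilotKummerNaturalWitness` type (where Θ- and q-regions agree up to
one indeterminacy). Nothing here is asserted; typed ≠ proved.
-/

noncomputable section

open Set

namespace Summit.ABC.IUTFork.Charitable.D4Derive

open Thm311 Cor312 Cor312Vol Literature.IUT.LogThetaLattice

variable {T : ThetaIndex} (S : LatticeSituation T) (P : Cor312.Setting S.toSituation)
  (ρ : (∀ v : T.V, v ∈ T.Vbad → Set (S.L.StarPacket v)) → ∀ (j : T.Label) (vQ : T.VQ), Set (S.L.Packet j vQ))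
  (qK : ∀ v : T.V, v ∈ T.Vbad → Set (S.L.StarPacket v))

/-! ## 1. Datum-level clause shapes (K2)–(K4) -/

/-- **(K3)** If the q-pilot's Kummer datum IS the splitting monoid of some possible image `D′ ∈ ⁿ′˒°ℜ^LGP` of the data of ANY
vertical line `n′`, then under Thm. 3.11 (i) `MultiradialCompat` (`ⁿ˒°ℜ^LGP = ⁿ′˒°ℜ^LGP`) the residual holds for EVERY region
operator `ρ` (no equivariance needed). [claim: Mochizuki2012, status: disputed] -/
theorem pilotKummerIndRelated_of_mem_RLGP (hMR : S.MultiradialCompat) {n' : ℤ} {D' : MRData S.L}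
    (hD' : D' ∈ S.RLGP n') (hq : ∀ (v : T.V) (hv : v ∈ T.Vbad), qK v hv = D'.Ψ v hv) :
    PilotKummerIndRelated S P ρ qK := fun j vQ => by
  refine ⟨D', ?_, ?_⟩
  · rw [hMR P.n n']; exact hD'
  · rw [show qK = D'.Ψ from funext fun v => funext fun hv => hq v hv]

/-- **(K2)** DATUM-LEVEL TRANSPORT FROM ANY COLUMN: if `qK` is the transport, along ONE element `Φ` of the indeterminacy
subgroup `⟨(Ind1) ∪ (Ind2)⟩`, of the column-`m` Kummer image of the Frobenius-like Θ splitting monoid of ANY column `n′` (for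
`n′ = n` this is abc-iut-w5-d068's `PilotKummerCompat`; for `n′ = n − 1` it is the link-faithful reading across the
Θ×μ_LGP-link `(n−1, m) → (n, m)`), then under Thm. 3.11 (i) `MultiradialCompat` and (ii)(b) for column `n′` the residual holds
for every `ρ`. [claim: Mochizuki2012, status: disputed] -/
theorem pilotKummerIndRelated_of_transportAt (hMR : S.MultiradialCompat) {n' : ℤ}
    (hKumB' : (S.col n').KummerB (S.D n')) {Φ : S.L.PacketAut}
    (hΦ : Φ ∈ Subgroup.closure (S.L.Ind1Family ∪ S.L.Ind2Family)) {m : ℤ}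
    (hq : ∀ (v : T.V) (hv : v ∈ T.Vbad), qK v hv = S.L.starAut Φ v '' (S.col n').frobΨ m v hv) :
    PilotKummerIndRelated S P ρ qK :=
  pilotKummerIndRelated_of_mem_RLGP S P ρ qK hMR (MRData.map_mem_RLGP (S.D n') hΦ) fun v hv => by
    rw [hq v hv, hKumB' m v hv]; rfl

/-- (K2) packaged over the existential form a typing is likely to use: «∃ n′ Φ m, qK = Φ · frobΨ_{n′} m» with (ii)(b) at
every column. [claim: Mochizuki2012, status: disputed] -/
theorem pilotKummerIndRelated_of_exists_transport (hMR : S.MultiradialCompat)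
    (hKumB : ∀ n' : ℤ, (S.col n').KummerB (S.D n'))
    (hq : ∃ n' : ℤ, ∃ Φ ∈ Subgroup.closure (S.L.Ind1Family ∪ S.L.Ind2Family), ∃ m : ℤ,
      ∀ (v : T.V) (hv : v ∈ T.Vbad), qK v hv = S.L.starAut Φ v '' (S.col n').frobΨ m v hv) :
    PilotKummerIndRelated S P ρ qK := by
  obtain ⟨n', Φ, hΦ, m, h⟩ := hq
  exact pilotKummerIndRelated_of_transportAt S P ρ qK hMR (hKumB n') hΦ h

/-- **(K4)** The literal «(Ind3)» variant: `qK` is the transport by one indeterminacy of the UNION over `m ∈ ℤ` of the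
column-`n′` Kummer images of the Θ splitting monoid. Under (ii)(b) for column `n′` that union is the coric `Ψ` (every
`frobΨ m = Ψ`), so (K2) applies. [claim: Mochizuki2012, status: disputed] -/
theorem pilotKummerIndRelated_of_transportUnion (hMR : S.MultiradialCompat) {n' : ℤ}
    (hKumB' : (S.col n').KummerB (S.D n')) {Φ : S.L.PacketAut}
    (hΦ : Φ ∈ Subgroup.closure (S.L.Ind1Family ∪ S.L.Ind2Family))
    (hq : ∀ (v : T.V) (hv : v ∈ T.Vbad), qK v hv = S.L.starAut Φ v '' ⋃ m : ℤ, (S.col n').frobΨ m v hv) :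
    PilotKummerIndRelated S P ρ qK := by
  refine pilotKummerIndRelated_of_transportAt S P ρ qK hMR hKumB' hΦ (m := 0) fun v hv => ?_
  rw [hq v hv]
  congr 1
  refine Set.Subset.antisymm (Set.iUnion_subset fun m => ?_) (Set.subset_iUnion (fun m : ℤ => (S.col n').frobΨ m v hv) 0)
  rw [hKumB' m v hv, hKumB' 0 v hv]

/-- (K2′) The LATTICE-INDEXED form a typing of (iii)(c) is likely to use: a family `X n m` of bad-place data («the Kummer
image at line `n+1`, through the Θ×μ_LGP-link `(n,m) → (n+1,m)`, of the pilot datum of `(n,m)`») with the clause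
«`∀ n m, ∃ Φ ∈ ⟨Ind1∪Ind2⟩, X (n+1) m = Φ · frobΨ_n m`»; if the pins' `qK` is `X` at the setting's own column `P.n` (for some
`m₀`), S follows by (K2) at `n′ = P.n − 1`. [claim: Mochizuki2012, status: disputed] -/
theorem pilotKummerIndRelated_of_succTransport (hMR : S.MultiradialCompat)
    (hKumB : ∀ n' : ℤ, (S.col n').KummerB (S.D n'))
    (X : ℤ → ℤ → ∀ v : T.V, v ∈ T.Vbad → Set (S.L.StarPacket v))
    (hX : ∀ n m : ℤ, ∃ Φ ∈ Subgroup.closure (S.L.Ind1Family ∪ S.L.Ind2Family),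
      ∀ (v : T.V) (hv : v ∈ T.Vbad), X (n + 1) m v hv = S.L.starAut Φ v '' (S.col n).frobΨ m v hv)
    {m₀ : ℤ} (hq : ∀ (v : T.V) (hv : v ∈ T.Vbad), qK v hv = X P.n m₀ v hv) :
    PilotKummerIndRelated S P ρ qK := by
  obtain ⟨Φ, hΦ, h⟩ := hX (P.n - 1) m₀
  rw [sub_add_cancel] at h
  exact pilotKummerIndRelated_of_transportAt S P ρ qK hMR (hKumB (P.n - 1)) hΦ fun v hv => by rw [hq v hv, h v hv]

/-- (K3′) The coric variant: `qK` IS the vertically coric splitting monoid `Ψ^⊥_LGP(ⁿ′˒°𝓗𝓣)` of some line `n′` (e.g. (ii)(b)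
read at the q-pilot's own column). [claim: Mochizuki2012, status: disputed] -/
theorem pilotKummerIndRelated_of_eq_coric (hMR : S.MultiradialCompat) {n' : ℤ}
    (hq : ∀ (v : T.V) (hv : v ∈ T.Vbad), qK v hv = (S.D n').Ψ v hv) : PilotKummerIndRelated S P ρ qK :=
  pilotKummerIndRelated_of_mem_RLGP S P ρ qK hMR (S.mem_RLGP_of_multiradialCompat hMR n' n') hq

/-! ## 2. Region-level clause shape (K5) -/

/-- **(K5)** REGION-LEVEL TRANSPORT FROM ANY COLUMN: if in every packet the `ρ`-region of `qK` is an indeterminacy-translate of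
the `ρ`-region of some column-`n′` Kummer image of the Θ splitting monoid (`n′`, `Φ`, `m` may depend on the packet), then under
the (hρ)-equivariance of the Θ-pin, Thm. 3.11 (i) and (ii)(b) at every column, the residual holds. (For `n′ = n` this is
abc-iut-w5-d068's `PilotKummerCompatRegion`, cf. `pilotKummerCompatRegion_iff_pilotKummerIndRelated`.)
[claim: Mochizuki2012, status: disputed] -/
theorem pilotKummerIndRelated_of_regionTransportAt (hMR : S.MultiradialCompat)
    (hKumB : ∀ n' : ℤ, (S.col n').KummerB (S.D n'))
    (hρ : ∀ Φ ∈ Subgroup.closure (S.L.Ind1Family ∪ S.L.Ind2Family),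
      ∀ (Ψ : ∀ v : T.V, v ∈ T.Vbad → Set (S.L.StarPacket v)) (j : T.Label) (vQ : T.VQ),
        ρ (fun v hv => S.L.starAut Φ v '' Ψ v hv) j vQ = Φ j vQ '' ρ Ψ j vQ)
    (hq : ∀ (j : T.Label) (vQ : T.VQ), ∃ n' : ℤ, ∃ Φ ∈ Subgroup.closure (S.L.Ind1Family ∪ S.L.Ind2Family), ∃ m : ℤ,
      ρ qK j vQ = Φ j vQ '' ρ ((S.col n').frobΨ m) j vQ) :
    PilotKummerIndRelated S P ρ qK := fun j vQ => by
  obtain ⟨n', Φ, hΦ, m, h⟩ := hq j vQ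
  refine ⟨(S.D n').map Φ, ?_, ?_⟩
  · rw [hMR P.n n']; exact MRData.map_mem_RLGP (S.D n') hΦ
  · have hΨ : (S.col n').frobΨ m = (S.D n').Ψ := funext fun v => funext fun hv => hKumB n' m v hv
    rw [h, hΨ, ← hρ Φ hΦ]
    rfl

/-! ## 2b. Glue-level clause shapes (K8): the setting's own regions related by one indeterminacy -/

/-- **Converse direction of the (K8) characterisation.** Under the two pins and (ii)(b) for column `n`, S implies the
glue-level translate clause «in every packet the q-pilot's region is an indeterminacy-translate of the Θ-pilot's Kummer-image
region at SOME lattice position `m`» (with `m = 0`, all `thetaRegion m` being equal). [claim: Mochizuki2012, status: disputed] -/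
theorem glueTranslate_of_pilotKummerIndRelated (hKumB : (S.col P.n).KummerB (S.D P.n)) (hpin : PinnedRegions S P ρ qK)
    (hS : PilotKummerIndRelated S P ρ qK) (j : T.Label) (vQ : T.VQ) :
    ∃ Φ ∈ Setting.indGroup S.toSituation, ∃ m : ℤ, P.qRegion j vQ = Φ j vQ '' P.thetaRegion m j vQ := by
  obtain ⟨Φ, hΦ, h⟩ := (reading3_iff_pilotKummerIndRelated S P ρ qK hKumB hpin).2 hS j vQ
  refine ⟨Φ, hΦ, 0, ?_⟩
  have hΨ : (S.col P.n).frobΨ 0 = (S.D P.n).Ψ := funext fun v => funext fun hv => hKumB 0 v hv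
  rw [h, hpin.1.2 0 j vQ, hΨ, thetaRegion3_eq_of_thetaPinned S P ρ hKumB hpin.1 j vQ]

/-- **(K8) — the kernel CHARACTERISATION of what a charitable reading must deliver** (GLUE LEVEL, a clause on the Cor. 3.12
setting's own regions rather than on Kummer data): granted the two region pins and Thm. 3.11 (ii)(b) for column `n`, S holds
IFF in every packet the q-pilot's region is an indeterminacy-translate of the Θ-pilot's Kummer-image region at SOME lattice
position `m` (Fig. 3.8's «two tautologically equivalent ways»; (xi-a) read on regions; (Ind3) collapses under (ii)(b): every
`thetaRegion m` is the one region `ρ Ψ_n`, so such a q-region is a possible image = READING R3). Hence task (a) closes for a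
charitable typing EXACTLY IF that typing (with the pins) yields the right-hand side, whatever vocabulary it uses; the backward
direction is the adapter (`(pilotKummerIndRelated_iff_glueTranslate …).2`). [claim: Mochizuki2012, status: disputed] -/
theorem pilotKummerIndRelated_iff_glueTranslate (hKumB : (S.col P.n).KummerB (S.D P.n)) (hpin : PinnedRegions S P ρ qK) :
    PilotKummerIndRelated S P ρ qK ↔
      ∀ (j : T.Label) (vQ : T.VQ), ∃ Φ ∈ Setting.indGroup S.toSituation, ∃ m : ℤ,
        P.qRegion j vQ = Φ j vQ '' P.thetaRegion m j vQ := by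
  refine ⟨fun hS j vQ => glueTranslate_of_pilotKummerIndRelated S P ρ qK hKumB hpin hS j vQ, fun hq => ?_⟩
  refine (reading3_iff_pilotKummerIndRelated S P ρ qK hKumB hpin).1 fun j vQ => ?_
  obtain ⟨Φ, hΦ, m, h⟩ := hq j vQ
  refine ⟨Φ, hΦ, ?_⟩
  have hΨ : (S.col P.n).frobΨ m = (S.D P.n).Ψ := funext fun v => funext fun hv => hKumB m v hv
  rw [h, hpin.1.2 m j vQ, thetaRegion3_eq_of_thetaPinned S P ρ hKumB hpin.1 j vQ, hΨ]

/-! ## 3. From S to the (xi-f) Licence (bookkeeping over the tree's bridges) -/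

/-- S under the pins and (ii)(b) gives READING R3 (q-region ∈ possible images) and hence abc-iut-c312-1's (xi-f) `Licence`.
[claim: Mochizuki2012, status: disputed] -/
theorem licence_of_s (hKumB : (S.col P.n).KummerB (S.D P.n)) (hpin : PinnedRegions3 S P ρ qK)
    (hS : PilotKummerIndRelated S P ρ qK) : Thm311ToCor312.Licence P :=
  Thm311ToCor312.licence_of_qRegion_mem_possibleImages P fun i vQ =>
    (reading3_iff_pilotKummerIndRelated S P ρ qK hKumB hpin.1).2 hS (Setting.labelSucc i) vQ

/-! ## 3b. What ANY successful derivation entails (schemas, for the referee's T-b line) -/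

section Schema

open Cor312Vol.NaiveWitness Cor312Vol.PinnedWitness

/-- **SCHEMA (T-b of block D for free).** A reading `C` of the arity of the pins from which S follows under the three pins
NECESSARILY FAILS at PR-2's pinned countermodel of record (abc-iut-w4-d101, `pinnedSetting p` / `orbitRegion p` / `qDatum p`,
p419720) — where the typed Thm. 3.11 (i)–(iii) (`naiveFull_statement`), `BridgeHyps`, `AbsLogQPos` and `PinnedRegions3` all HOLD and
S fails (`pinnedSetting_not_pilotKummerIndRelated`). So a charitable re-typing that closes (a) has content the frozen typing lacks AT
THAT MODEL; whether that content is print's is the referee's question (c), untouched here. [folklore] -/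
theorem schema_not_holds_at_pinnedSetting
    (C : ∀ {T : ThetaIndex} (S : LatticeSituation T) (P : Cor312.Setting S.toSituation),
      ((∀ v : T.V, v ∈ T.Vbad → Set (S.L.StarPacket v)) → ∀ (j : T.Label) (vQ : T.VQ), Set (S.L.Packet j vQ)) →
      (∀ v : T.V, v ∈ T.Vbad → Set (S.L.StarPacket v)) → Prop)
    (hC : ∀ {T : ThetaIndex} (S : LatticeSituation T) (P : Cor312.Setting S.toSituation)
      (ρ : (∀ v : T.V, v ∈ T.Vbad → Set (S.L.StarPacket v)) → ∀ (j : T.Label) (vQ : T.VQ), Set (S.L.Packet j vQ))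
      (qK : ∀ v : T.V, v ∈ T.Vbad → Set (S.L.StarPacket v)),
      C S P ρ qK → PinnedRegions3 S P ρ qK → PilotKummerIndRelated S P ρ qK)
    (p : ℕ) [Fact p.Prime] :
    ¬ C (naiveFull p).toLatticeSituation (pinnedSetting p) (orbitRegion p) (qDatum p) := fun h =>
  pinnedSetting_not_pilotKummerIndRelated p (hC _ _ _ _ h (pinnedSetting_pinnedRegions3 p))

end Schema

end Summit.ABC.IUTFork.Charitable.D4Derive

end
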